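import Literature.Analysis.FluidPDE.FiniteFourierModeEulerKeyA

/-!
# Kishimoto–Yoneda, Prop. 4.4 (iv) / Prop. 4.7 at the vertex of maximal length, II: conclusion

Support file for `FiniteFourierModeEuler` (N. Kishimoto, T. Yoneda, J. Math. Fluid Mech. 24
(2022) 74 = arXiv:2110.08039). We finish the Gauss–Bonnet argument of Props. 4.4 (iv) / 4.7 at the
vertex `p₀` of maximal length of a spanning support set `S`, at a time at which all modes are
occupied: by `dot_self_eq_zero_or_polyProd_real` either `u_{p₀}·u_{p₀} = 0` or the frame-factor
product around the boundary polygon of a face at `p₀` is real; in the latter case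
`sin (Σ_j E_j) = 0` for the angular excesses of the fan triangles (`sin_sum_excess_eq_zero`,
Lemma 4.6), while `Σ_j E_j = 4π Σ_j vol(T_j ∩ B)/vol(B) ∈ (0, 2π/3]` for the face of small solid
angle of `exists_small_facet` ("`A(F̂*) ≤ 2π/3 < π`") — a contradiction. Hence
`u_{p₀}·u_{p₀} = 0`, so `u_{p₀}` is a (complex) Beltrami vector (`exists_isBV_of_dot_self_eq_zero`):
`p₀` is the vertex with `ω̂ ∥ û` from which Prop. 4.4 (iii) propagates (`forall_isBV`).

## References

* [KishimotoYoneda2022] N. Kishimoto, T. Yoneda, J. Math. Fluid Mech. 24 (2022) 74 =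
  arXiv:2110.08039, §4 Lemma 4.6, Prop. 4.4 (iv), Prop. 4.7 and their proofs.
-/

noncomputable section

open Matrix Set Finset Complex MeasureTheory

namespace Literature.Analysis.FluidPDE

namespace KY

open scoped Classical

/-! ### The round ball has positive finite volume -/

/-- `0 < vol(ball₃ 1)`. [folklore] -/
theorem volume_ball₃_one_pos : 0 < volume (ball₃ 1) := by
  have hsub : Metric.ball (0 : Fin 3 → ℝ) (1 / 2) ⊆ ball₃ 1 := by
    intro x hx
    rw [Metric.mem_ball, dist_zero_right] at hx
    have h : ∀ i, |x i| < 1 / 2 := fun i =>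
      lt_of_le_of_lt (by simpa using norm_le_pi_norm x i) hx
    have h0 := abs_lt.1 (h 0); have h1 := abs_lt.1 (h 1); have h2 := abs_lt.1 (h 2)
    show x ⬝ᵥ x < 1
    rw [real_dot_eq]; nlinarith
  exact lt_of_lt_of_le (Metric.measure_ball_pos volume _ (by norm_num)) (measure_mono hsub)

/-- `(vol(ball₃ 1)).toReal > 0`. [folklore] -/
theorem volume_ball₃_one_toReal_pos : 0 < (volume (ball₃ 1)).toReal :=
  ENNReal.toReal_pos volume_ball₃_one_pos.ne' (volume_ball₃_lt_top 1).ne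

/-! ### The fan of open trihedral cones over the boundary polygon -/

namespace FaceCfg

section Fan

variable {S : Finset (Fin 3 → ℝ)} {φ p₀ : Fin 3 → ℝ} (cfg : FaceCfg S φ p₀ 1)
include cfg

/-- Shorthand for the polygon. -/
local notation "q" => FaceCfg.poly S φ p₀ 1
/-- Shorthand for the number of vertices. -/
local notation "m" => FaceCfg.nverts S φ p₀ 1

/-- The fan triangles `(p₀, q_i, q_{i+1})` and `(p₀, q_j, q_{j+1})`, `i < j`, span disjoint open
cones: the plane through `0, p₀, q_{i+1}` separates them. [folklore] -/
theorem disjoint_fan {i j : ℕ} (hi : 1 ≤ i) (hij : i < j) (hj : j + 1 ≤ m) :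
    Disjoint (triCone p₀ (q i) (q (i + 1))) (triCone p₀ (q j) (q (j + 1))) := by
  rw [Set.disjoint_left]
  intro x hx hx'
  -- barycentric coordinates in the two cones
  have hτ : 0 < p₀ ⬝ᵥ (q i ⨯₃ q (i + 1)) := cfg.triple_poly_pos hi (Nat.lt_succ_self i) (by omega)
  have hτ' : 0 < p₀ ⬝ᵥ (q j ⨯₃ q (j + 1)) := cfg.triple_poly_pos (by omega) (Nat.lt_succ_self j) hj
  obtain ⟨⟨hx1, hx2⟩, hx3⟩ := hx
  obtain ⟨⟨hx1', hx2'⟩, hx3'⟩ := hx'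
  simp only [halfSpace, mem_setOf_eq] at hx1 hx2 hx3 hx1' hx2' hx3'
  -- the separating functional `L y = [p₀, q_{i+1}, y]`
  have hid := baryc_identity (a := p₀) (b := q i) (c := q (i + 1)) (x := x) hτ.ne'
  have hid' := baryc_identity (a := p₀) (b := q j) (c := q (j + 1)) (x := x) hτ'.ne'
  have L1 : p₀ ⬝ᵥ (q (i + 1) ⨯₃ x) = (p₀ ⬝ᵥ (x ⨯₃ q (i + 1))) / (p₀ ⬝ᵥ (q i ⨯₃ q (i + 1)))
      * (p₀ ⬝ᵥ (q (i + 1) ⨯₃ q i)) := by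
    conv_lhs => rw [hid]
    simp only [map_add, map_smul, dotProduct_add, dotProduct_smul, smul_eq_mul, cross_self,
      dotProduct_zero, mul_zero, add_zero, dot_cross_self]
    ring
  have L2 : p₀ ⬝ᵥ (q (i + 1) ⨯₃ x) = (p₀ ⬝ᵥ (x ⨯₃ q (j + 1))) / (p₀ ⬝ᵥ (q j ⨯₃ q (j + 1)))
      * (p₀ ⬝ᵥ (q (i + 1) ⨯₃ q j)) + (p₀ ⬝ᵥ (q j ⨯₃ x)) / (p₀ ⬝ᵥ (q j ⨯₃ q (j + 1)))
      * (p₀ ⬝ᵥ (q (i + 1) ⨯₃ q (j + 1))) := by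
    conv_lhs => rw [hid']
    simp only [map_add, map_smul, dotProduct_add, dotProduct_smul, smul_eq_mul, dot_cross_self,
      mul_zero, zero_add]
  -- signs
  have hβ : 0 < p₀ ⬝ᵥ (x ⨯₃ q (i + 1)) := by
    have : p₀ ⬝ᵥ (x ⨯₃ q (i + 1)) = x ⬝ᵥ (q (i + 1) ⨯₃ p₀) := by
      simp [cross_apply, dotProduct, Fin.sum_univ_three]; ring
    rw [this]; exact hx2
  have hneg : p₀ ⬝ᵥ (q (i + 1) ⨯₃ q i) < 0 := by
    rw [← cross_anticomm, dotProduct_neg, neg_neg_iff_pos]; exact hτ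
  have hLneg : p₀ ⬝ᵥ (q (i + 1) ⨯₃ x) < 0 := by
    rw [L1]; exact mul_neg_of_pos_of_neg (div_pos hβ hτ) hneg
  have hβ' : 0 < p₀ ⬝ᵥ (x ⨯₃ q (j + 1)) := by
    have : p₀ ⬝ᵥ (x ⨯₃ q (j + 1)) = x ⬝ᵥ (q (j + 1) ⨯₃ p₀) := by
      simp [cross_apply, dotProduct, Fin.sum_univ_three]; ring
    rw [this]; exact hx2'
  have hγ' : 0 < p₀ ⬝ᵥ (q j ⨯₃ x) := by
    have : p₀ ⬝ᵥ (q j ⨯₃ x) = x ⬝ᵥ (p₀ ⨯₃ q j) := by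
      simp [cross_apply, dotProduct, Fin.sum_univ_three]; ring
    rw [this]; exact hx3'
  have h1 : 0 ≤ p₀ ⬝ᵥ (q (i + 1) ⨯₃ q j) := by
    rcases (Nat.succ_le_of_lt hij).lt_or_eq with hlt | heq
    · exact (cfg.triple_poly_pos (by omega) hlt (by omega)).le
    · obtain rfl : j = i + 1 := by omega
      rw [cross_self, dotProduct_zero]
  have h2 : 0 < p₀ ⬝ᵥ (q (i + 1) ⨯₃ q (j + 1)) := cfg.triple_poly_pos (by omega) (by omega) hj
  have hLpos : 0 < p₀ ⬝ᵥ (q (i + 1) ⨯₃ x) := by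
    rw [L2]
    have t1 : 0 ≤ (p₀ ⬝ᵥ (x ⨯₃ q (j + 1))) / (p₀ ⬝ᵥ (q j ⨯₃ q (j + 1))) * (p₀ ⬝ᵥ (q (i + 1) ⨯₃ q j)) :=
      mul_nonneg (div_pos hβ' hτ').le h1
    have t2 : 0 < (p₀ ⬝ᵥ (q j ⨯₃ x)) / (p₀ ⬝ᵥ (q j ⨯₃ q (j + 1))) * (p₀ ⬝ᵥ (q (i + 1) ⨯₃ q (j + 1))) :=
      mul_pos (div_pos hγ' hτ') h2
    linarith
  linarith

/-- The open cone of a positively oriented fan triangle meets the unit ball in positive volume.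
[folklore] -/
theorem volume_fan_pos {j : ℕ} (hj : 1 ≤ j) (hj1 : j + 1 ≤ m) :
    0 < volume (triCone p₀ (q j) (q (j + 1)) ∩ ball₃ 1) := by
  have hτ : 0 < p₀ ⬝ᵥ (q j ⨯₃ q (j + 1)) := cfg.triple_poly_pos hj (Nat.lt_succ_self j) hj1
  -- an interior point `ε (p₀ + q_j + q_{j+1})`
  set w : Fin 3 → ℝ := p₀ + q j + q (j + 1) with hw
  have hw1 : 0 < w ⬝ᵥ (q j ⨯₃ q (j + 1)) := by
    rw [hw, add_dotProduct, add_dotProduct, dot_self_cross, dot_cross_self, add_zero, add_zero]; exact hτ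
  have hw2 : 0 < w ⬝ᵥ (q (j + 1) ⨯₃ p₀) := by
    have e : ∀ y : Fin 3 → ℝ, y ⬝ᵥ (q (j + 1) ⨯₃ p₀) = p₀ ⬝ᵥ (y ⨯₃ q (j + 1)) := by
      intro y; simp [cross_apply, dotProduct, Fin.sum_univ_three]; ring
    rw [e, hw, map_add, map_add, LinearMap.add_apply, LinearMap.add_apply, dotProduct_add,
      dotProduct_add, dot_self_cross, cross_self, dotProduct_zero, zero_add, add_zero]; exact hτ
  have hw3 : 0 < w ⬝ᵥ (p₀ ⨯₃ q j) := by
    have e : ∀ y : Fin 3 → ℝ, y ⬝ᵥ (p₀ ⨯₃ q j) = p₀ ⬝ᵥ (q j ⨯₃ y) := by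
      intro y; simp [cross_apply, dotProduct, Fin.sum_univ_three]; ring
    rw [e, hw, map_add, map_add, dotProduct_add, dotProduct_add, cross_self, dotProduct_zero,
      ← cross_anticomm p₀ (q j), dotProduct_neg, dot_self_cross, neg_zero, zero_add, zero_add]; exact hτ
  -- openness
  have hopen : IsOpen (triCone p₀ (q j) (q (j + 1)) ∩ ball₃ 1) := by
    have hc : ∀ n : Fin 3 → ℝ, Continuous fun x : Fin 3 → ℝ => x ⬝ᵥ n := by
      intro n; unfold dotProduct; fun_prop
    have ho : ∀ n : Fin 3 → ℝ, IsOpen (halfSpace n) := fun n => isOpen_lt continuous_const (hc n)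
    have hb : IsOpen (ball₃ 1) := by
      have : Continuous fun x : Fin 3 → ℝ => x ⬝ᵥ x := by unfold dotProduct; fun_prop
      exact isOpen_lt this continuous_const
    exact (((ho _).inter (ho _)).inter (ho _)).inter hb
  -- a point of the set
  have hww : 0 < w ⬝ᵥ w := by
    rcases (show 0 ≤ w ⬝ᵥ w by rw [real_dot_eq]; nlinarith [sq_nonneg (w 0), sq_nonneg (w 1), sq_nonneg (w 2)]).lt_or_eq with h | h
    · exact h
    · exfalso
      have : w = 0 := dotProduct_self_eq_zero.1 h.symm
      rw [this, zero_dotProduct] at hw1; exact lt_irrefl _ hw1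
  set ε : ℝ := 1 / (2 * Real.sqrt (w ⬝ᵥ w)) with hε
  have hεpos : 0 < ε := by rw [hε]; positivity
  have hmem : ε • w ∈ triCone p₀ (q j) (q (j + 1)) ∩ ball₃ 1 := by
    refine ⟨⟨⟨?_, ?_⟩, ?_⟩, ?_⟩
    · show 0 < (ε • w) ⬝ᵥ _; rw [smul_dotProduct, smul_eq_mul]; exact mul_pos hεpos hw1
    · show 0 < (ε • w) ⬝ᵥ _; rw [smul_dotProduct, smul_eq_mul]; exact mul_pos hεpos hw2
    · show 0 < (ε • w) ⬝ᵥ _; rw [smul_dotProduct, smul_eq_mul]; exact mul_pos hεpos hw3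
    · show (ε • w) ⬝ᵥ (ε • w) < 1
      rw [smul_dotProduct, dotProduct_smul, smul_eq_mul, smul_eq_mul, hε]
      have hs : Real.sqrt (w ⬝ᵥ w) ^ 2 = w ⬝ᵥ w := Real.sq_sqrt hww.le
      have hspos : 0 < Real.sqrt (w ⬝ᵥ w) := Real.sqrt_pos.2 hww
      have hs0 : Real.sqrt (w ⬝ᵥ w) ≠ 0 := hspos.ne'
      rw [show 1 / (2 * Real.sqrt (w ⬝ᵥ w)) * (1 / (2 * Real.sqrt (w ⬝ᵥ w)) * (w ⬝ᵥ w))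
          = (w ⬝ᵥ w) / (4 * Real.sqrt (w ⬝ᵥ w) ^ 2) by field_simp; ring, hs,
        div_lt_one (by positivity)]
      linarith
  exact hopen.measure_pos volume ⟨ε • w, hmem⟩

/-- **The fan triangles of a face of small solid angle have total excess in `(0, 2π/3]`.**
[cite: KishimotoYoneda2022, §4 proof of Prop. 4.4 (iv) ("`A(F̂*) ≤ 2π/3`")] -/
theorem sum_excess_bounds {C : Set (Fin 3 → ℝ)}
    (hvol : 6 * volume (C ∩ ball₃ 1) ≤ volume (ball₃ 1))
    (hcone : ∀ j, 1 ≤ j → j + 1 ≤ m → triCone p₀ (q j) (q (j + 1)) ⊆ C) :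
    0 < ∑ j ∈ Finset.Ico 1 m, excess p₀ (q j) (q (j + 1)) ∧
      ∑ j ∈ Finset.Ico 1 m, excess p₀ (q j) (q (j + 1)) ≤ 2 * Real.pi / 3 := by
  have hm2 : 2 ≤ m := cfg.two_le_nverts
  have hV := volume_ball₃_one_toReal_pos
  have hVtop := (volume_ball₃_lt_top 1).ne
  set V := (volume (ball₃ 1)).toReal with hVdef
  set T : ℕ → Set (Fin 3 → ℝ) := fun j => triCone p₀ (q j) (q (j + 1)) ∩ ball₃ 1 with hT
  have hE : ∀ j ∈ Finset.Ico 1 m, excess p₀ (q j) (q (j + 1)) = 4 * Real.pi * (volume (T j)).toReal / V := by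
    intro j hj
    rw [Finset.mem_Ico] at hj
    exact excess_eq (cfg.triple_poly_pos hj.1 (Nat.lt_succ_self j) hj.2) hV.ne'
  rw [Finset.sum_congr rfl hE]
  have hTfin : ∀ j, volume (T j) ≠ ⊤ := fun j =>
    (lt_of_le_of_lt (measure_mono Set.inter_subset_right) (volume_ball₃_lt_top 1)).ne
  constructor
  · -- positivity: the first term is positive, all are non-negative
    have hpos : ∀ j ∈ Finset.Ico 1 m, 0 < 4 * Real.pi * (volume (T j)).toReal / V := by
      intro j hj
      rw [Finset.mem_Ico] at hj
      have := ENNReal.toReal_pos (cfg.volume_fan_pos hj.1 hj.2).ne' (hTfin j)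
      positivity
    exact Finset.sum_pos hpos ⟨1, Finset.mem_Ico.2 ⟨le_rfl, by omega⟩⟩
  · -- the cones are disjoint and contained in `C`
    have hsum : ∑ j ∈ Finset.Ico 1 m, volume (T j) ≤ volume (C ∩ ball₃ 1) := by
      rw [← measure_biUnion_finset]
      · apply measure_mono
        intro x hx
        simp only [Set.mem_iUnion] at hx
        obtain ⟨j, hj, hxj⟩ := hx
        have hj' : 1 ≤ j ∧ j < m := by simpa using hj
        exact ⟨hcone j hj'.1 hj'.2 hxj.1, hxj.2⟩
      · intro i hi j hj hij
        simp only [Finset.mem_coe, Finset.mem_Ico] at hi hj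
        rcases lt_or_gt_of_ne hij with h | h
        · exact Disjoint.mono Set.inter_subset_left Set.inter_subset_left (cfg.disjoint_fan hi.1 h hj.2)
        · exact (Disjoint.mono Set.inter_subset_left Set.inter_subset_left
            (cfg.disjoint_fan hj.1 h hi.2)).symm
      · intro j _; exact (measurableSet_triCone _ _ _).inter (measurableSet_ball₃ 1)
    have hCfin : volume (C ∩ ball₃ 1) ≠ ⊤ :=
      (lt_of_le_of_lt (measure_mono Set.inter_subset_right) (volume_ball₃_lt_top 1)).ne
    have hsumR : ∑ j ∈ Finset.Ico 1 m, (volume (T j)).toReal ≤ (volume (C ∩ ball₃ 1)).toReal := by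
      rw [← ENNReal.toReal_sum fun j _ => hTfin j]
      exact (ENNReal.toReal_le_toReal (ENNReal.sum_ne_top.2 fun j _ => hTfin j) hCfin).2 hsum
    have hvolR : 6 * (volume (C ∩ ball₃ 1)).toReal ≤ V := by
      have := (ENNReal.toReal_le_toReal (by simpa using ENNReal.mul_ne_top (by norm_num) hCfin) hVtop).2 hvol
      simpa [ENNReal.toReal_mul] using this
    have : ∑ j ∈ Finset.Ico 1 m, 4 * Real.pi * (volume (T j)).toReal / V
        = 4 * Real.pi / V * ∑ j ∈ Finset.Ico 1 m, (volume (T j)).toReal := by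
      rw [Finset.mul_sum]; refine Finset.sum_congr rfl fun j _ => ?_; ring
    rw [this]
    have hpi := Real.pi_pos
    calc 4 * Real.pi / V * ∑ j ∈ Finset.Ico 1 m, (volume (T j)).toReal
        ≤ 4 * Real.pi / V * (V / 6) := by
          apply mul_le_mul_of_nonneg_left _ (by positivity)
          linarith
      _ = 2 * Real.pi / 3 := by field_simp; ring

end Fan

end FaceCfg

/-! ### The vertex of maximal length is a Beltrami vertex -/

namespace IsFiniteModeEulerSolution

variable {I : Set ℝ} {S : Finset (Fin 3 → ℝ)} {u : (Fin 3 → ℝ) → ℝ → (Fin 3 → ℂ)}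

/-- **Kishimoto–Yoneda, Prop. 4.4 (iv) (the key vertex).** Let `S` span `ℝ³` and let all modes of
`S` be occupied at the time `t ∈ I`. Then at a frequency `n₁ ∈ S` of maximal length the velocity
coefficient is a complex Beltrami vector: `i n₁ × û = μ û`. (Gauss–Bonnet around the boundary of a
face of `S^{conv}` at `n₁` of solid angle `≤ 4π/6`: Lemmas 4.5, 4.6 and the six faces of the
symmetric polyhedron.) [cite: KishimotoYoneda2022, §4 Prop. 4.4 (iv), Prop. 4.7] -/
theorem exists_isBV_farthest (hS : IsFiniteModeEulerSolution I S u) {t : ℝ} (ht : t ∈ I)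
    (hgen : ∀ n ∈ S, u n t ≠ 0) (hspan : ∃ a ∈ S, ∃ b ∈ S, ∃ c ∈ S, a ⬝ᵥ (b ⨯₃ c) ≠ 0)
    {n₁ : Fin 3 → ℝ} (hn₁ : n₁ ∈ S) (hR : ∀ s ∈ S, s ⬝ᵥ s ≤ n₁ ⬝ᵥ n₁) :
    ∃ μ : ℝ, IsBV μ n₁ (u n₁ t) := by
  have hfar := exposed_of_dot_self_eq_max hR
  have h0 : (0 : Fin 3 → ℝ) ∉ S := hS.zero_notMem
  have hn0 : n₁ ≠ 0 := fun h => h0 (h ▸ hn₁)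
  obtain ⟨φ, hφ, C, -, hvol, hcones⟩ := exists_small_facet h0 hS.neg_mem hspan hn₁ hfar 1
  have cfg : FaceCfg S φ n₁ 1 := hφ.faceCfg hn₁ hfar
  apply exists_isBV_of_dot_self_eq_zero hn0 (hgen n₁ hn₁) (hS.div_free n₁ hn₁ t ht)
  rcases hS.dot_self_eq_zero_or_polyProd_real ht hgen cfg with h | hreal
  · exact h
  · exfalso
    have hm2 := cfg.two_le_nverts
    have hq0 : FaceCfg.poly S φ n₁ 1 0 = n₁ := FaceCfg.poly_zero
    -- the excess sum has vanishing sine …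
    have hsin := sin_sum_excess_eq_zero (q := FaceCfg.poly S φ n₁ 1) hm2
      (fun j hj hjm => by rw [hq0]; exact cfg.triple_poly_pos hj (Nat.lt_succ_self j) hjm) hreal
    rw [hq0] at hsin
    -- … but lies in `(0, 2π/3]`
    have hmem : ∀ j, j ≤ FaceCfg.nverts S φ n₁ 1 + 1 →
        FaceCfg.poly S φ n₁ 1 j ∈ S ∧ φ ⬝ᵥ FaceCfg.poly S φ n₁ 1 j = 1 := by
      intro j hj
      obtain ⟨h1, h2⟩ := Finset.mem_filter.1 (cfg.poly_mem_face' hj).1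
      exact ⟨h1, by rw [dotProduct_comm]; exact h2⟩
    have hcone : ∀ j, 1 ≤ j → j + 1 ≤ FaceCfg.nverts S φ n₁ 1 →
        triCone n₁ (FaceCfg.poly S φ n₁ 1 j) (FaceCfg.poly S φ n₁ 1 (j + 1)) ⊆ C := by
      intro j hj hjm
      exact hcones n₁ hn₁ _ (hmem j (by omega)).1 _ (hmem (j + 1) (by omega)).1 hφ.2.1
        (hmem j (by omega)).2 (hmem (j + 1) (by omega)).2
        (cfg.triple_poly_pos hj (Nat.lt_succ_self j) hjm)
    obtain ⟨hpos, hle⟩ := cfg.sum_excess_bounds hvol hcone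
    have := Real.sin_pos_of_pos_of_lt_pi hpos (by linarith [Real.pi_pos])
    rw [hsin] at this
    exact lt_irrefl _ this

end IsFiniteModeEulerSolution

end KY

end Literature.Analysis.FluidPDE
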